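import Literature.NumberTheory.EllipticCurves.BinaryQuarticStabilizer
import Literature.Algebra.Polynomial.RealCubicRoots
import Mathlib.Analysis.SpecialFunctions.Pow.Real
import HarnessLib

/-!
# Bhargava–Shankar, Lemma 2.2: the stabiliser of a real binary quartic form in `GL₂(ℝ)` has
# order `8` (`Δ > 0`) or `4` (`Δ < 0`)

Topic `Literature/NumberTheory/EllipticCurves`; companion of `BinaryQuarticStabilizer.lean`
(`BinaryQuartic.pgl2StabilizerCard_eq`: the stabiliser of `f`, `Δ(f) ≠ 0`, in `PGL₂(K)` for the
twisted action has `1 + #{K-roots of φ³ − 3Iφ + J}` elements) and of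
`Literature/Algebra/Polynomial/RealCubicRoots.lean` (a real cubic has `3` or `1` real roots
according to the sign of its discriminant).

M. Bhargava, A. Shankar, *Binary quartic forms having bounded invariants, and the boundedness of
the average rank of elliptic curves*, Ann. of Math. (2) 181 (2015), **Lemma 2.2** (both the held
arXiv text `arXiv:1006.1002v2` and the published version; proof deferred there to the appendix on
auxiliary lemmas): *"Let `f` be an element in `V_ℝ^{(i)}` having nonzero discriminant. Then the
order of the stabilizer of `f` in `GL₂(ℝ)` is `8` if `i = 0` or `2`, and `4` if `i = 1`."* Here
`GL₂(ℝ)` acts by plain substitution `γ · f(x,y) = f((x,y)γ)` (§2, eq. (4)), `V_ℝ^{(0)}, V_ℝ^{(2)}`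
are the forms with `Δ > 0` (four or no real roots) and `V_ℝ^{(1)}` those with `Δ < 0`. These orders
`2n_i` (`n₀ = n₂ = 4`, `n₁ = 2`) enter Thm 2.1 through "`𝓕hL` is the union of `n_i` fundamental
domains".

## Proof

A plain stabiliser `γ` (`f((x,y)γ) = f`) has `(det γ)² = 1` (compare `I`, `J`, not both zero as
`Δ ≠ 0`), so lies in the twisted stabiliser; conversely each class `ℝˣγ` of the twisted stabiliser
contains exactly the two plain stabilisers `±|det γ|^{-1/2} γ`. Hence
`#Stab_{GL₂(ℝ)}(f) = 2 · #Stab_{PGL₂(ℝ)}(f) = 2(1 + #{real roots of φ³ − 3Iφ + J})`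
(`ncard_substStabilizer_eq`), and the resolvent has discriminant `27²Δ(f)`, so three real roots if
`Δ > 0` and one if `Δ < 0` (`ncard_substStabilizer_of_disc_pos`, `ncard_substStabilizer_of_disc_neg`).

## References

* [BhargavaShankarAnnals2015] Lemma 2.2; §2 eq. (4) (the action); §2.1 (`n_i`).
  [cite: BhargavaShankarAnnals2015, Lemma 2.2]
-/

noncomputable section

open scoped Classical
open Matrix

namespace Literature.NumberTheory.EllipticCurves

namespace BinaryQuartic

/-- The stabiliser of `f` in `GL₂(ℝ)` for the plain substitution action `γ · f(x,y) = f((x,y)γ)`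
(Bhargava–Shankar 2015, §2 eq. (4) and Lemma 2.2); for `Δ(f) ≠ 0` its elements are automatically
invertible (`det_ne_zero_of_mem_substStabilizer`). [cite: BhargavaShankarAnnals2015, Lemma 2.2 (stabilizer in GL₂(ℝ))] -/
def substStabilizer (f : BinaryQuartic ℝ) : Set (Matrix (Fin 2) (Fin 2) ℝ) :=
  {γ | f.subst γ = f}

variable {f : BinaryQuartic ℝ}

/-- `I` and `J` of a form with `Δ ≠ 0` are not both zero (`27Δ = 4I³ − J²`). [folklore] -/
theorem I_ne_zero_or_J_ne_zero (hΔ : f.disc ≠ 0) : f.I ≠ 0 ∨ f.J ≠ 0 := by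
  by_contra h
  push Not at h
  apply hΔ
  have h27 := twentySeven_mul_disc f
  rw [h.1, h.2] at h27
  linarith [h27]

/-- A plain stabiliser of a form with `Δ ≠ 0` has `(det γ)² = 1`. [folklore] -/
theorem det_sq_eq_one_of_mem_substStabilizer (hΔ : f.disc ≠ 0) {γ : Matrix (Fin 2) (Fin 2) ℝ}
    (hγ : γ ∈ substStabilizer f) : γ.det ^ 2 = 1 := by
  have hI : f.I = γ.det ^ 4 * f.I := by
    conv_lhs => rw [← show f.subst γ = f from hγ]
    exact I_subst f γ
  have hJ : f.J = γ.det ^ 6 * f.J := by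
    conv_lhs => rw [← show f.subst γ = f from hγ]
    exact J_subst f γ
  have h2 : 0 ≤ γ.det ^ 2 := sq_nonneg _
  rcases I_ne_zero_or_J_ne_zero hΔ with h | h
  · have h4 : γ.det ^ 4 = 1 := by
      have : (γ.det ^ 4 - 1) * f.I = 0 := by linear_combination -hI
      simpa [sub_eq_zero, h] using this
    have : (γ.det ^ 2 - 1) * (γ.det ^ 2 + 1) = 0 := by linear_combination h4
    rcases mul_eq_zero.mp this with h' | h'
    · linarith
    · nlinarith
  · have h6 : γ.det ^ 6 = 1 := by
      have : (γ.det ^ 6 - 1) * f.J = 0 := by linear_combination -hJ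
      simpa [sub_eq_zero, h] using this
    have : (γ.det ^ 2 - 1) * ((γ.det ^ 2) ^ 2 + γ.det ^ 2 + 1) = 0 := by linear_combination h6
    rcases mul_eq_zero.mp this with h' | h'
    · linarith
    · nlinarith

/-- A plain stabiliser of a form with `Δ ≠ 0` is invertible. [folklore] -/
theorem det_ne_zero_of_mem_substStabilizer (hΔ : f.disc ≠ 0) {γ : Matrix (Fin 2) (Fin 2) ℝ}
    (hγ : γ ∈ substStabilizer f) : γ.det ≠ 0 := by
  intro h0
  have := det_sq_eq_one_of_mem_substStabilizer hΔ hγ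
  rw [h0] at this
  norm_num at this

/-- **Plain stabilisers are twisted stabilisers** (`Δ ≠ 0`). [folklore] -/
theorem mem_stabilizerSet_of_mem_substStabilizer (hΔ : f.disc ≠ 0) {γ : Matrix (Fin 2) (Fin 2) ℝ}
    (hγ : γ ∈ substStabilizer f) : γ ∈ stabilizerSet f := by
  rw [mem_stabilizerSet_iff]
  refine ⟨det_ne_zero_of_mem_substStabilizer hΔ hγ, ?_⟩
  rw [det_sq_eq_one_of_mem_substStabilizer hΔ hγ, one_smul]
  exact hγ

/-- Scaling a matrix scales the substituted form by the fourth power. [folklore] -/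
theorem subst_smul_matrix (g : BinaryQuartic ℝ) (c : ℝ) (γ : Matrix (Fin 2) (Fin 2) ℝ) :
    g.subst (c • γ) = (c ^ 4) • g.subst γ := by
  ext <;> simp only [subst, Matrix.smul_apply, smul_eq_mul, smul_a, smul_b, smul_c, smul_d,
    smul_e] <;> ring

/-- A form with `Δ ≠ 0` is not the zero form: scaling it by `μ` gives it back only for `μ = 1`.
[folklore] -/
theorem eq_one_of_smul_eq (hΔ : f.disc ≠ 0) {μ : ℝ} (h : μ • f = f) : μ = 1 := by
  by_contra hμ
  have hz : ∀ t : ℝ, μ * t = t → t = 0 := fun t ht ↦ by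
    have : (μ - 1) * t = 0 := by linear_combination ht
    exact (mul_eq_zero.mp this).resolve_left (sub_ne_zero.mpr hμ)
  have ha := hz _ (by simpa using congrArg BinaryQuartic.a h)
  have hb := hz _ (by simpa using congrArg BinaryQuartic.b h)
  have hc := hz _ (by simpa using congrArg BinaryQuartic.c h)
  have hd := hz _ (by simpa using congrArg BinaryQuartic.d h)
  have he := hz _ (by simpa using congrArg BinaryQuartic.e h)
  apply hΔ
  simp [disc, ha, hb, hc, hd, he]

/-- **The plain stabilisers in the class `ℝˣγ` of a twisted stabiliser are exactly `±|det γ|^{-1/2} γ`.**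
For `γ ∈ Stab(f)` and `c ∈ ℝ`: `cγ` is a plain stabiliser iff `c⁴ (det γ)² = 1`. [folklore] -/
theorem smul_mem_substStabilizer_iff (hΔ : f.disc ≠ 0) {γ : Matrix (Fin 2) (Fin 2) ℝ}
    (hγ : γ ∈ stabilizerSet f) (c : ℝ) :
    c • γ ∈ substStabilizer f ↔ c ^ 4 * γ.det ^ 2 = 1 := by
  rw [mem_stabilizerSet_iff] at hγ
  obtain ⟨hdet, hsub⟩ := hγ
  simp only [substStabilizer, Set.mem_setOf_eq, subst_smul_matrix, hsub, smul_smul]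
  constructor
  · exact eq_one_of_smul_eq hΔ
  · intro h; rw [h, one_smul]

/-- The positive scaling factor `c_γ = |det γ|^{-1/2}` with `c_γ⁴ (det γ)² = 1`. [folklore] -/
theorem rpow_spec {d : ℝ} (hd : d ≠ 0) :
    0 < |d| ^ (-(1 / 2 : ℝ)) ∧ (|d| ^ (-(1 / 2 : ℝ))) ^ 4 * d ^ 2 = 1 := by
  have hpos : 0 < |d| := abs_pos.mpr hd
  refine ⟨Real.rpow_pos_of_pos hpos _, ?_⟩
  rw [← Real.rpow_natCast, ← Real.rpow_mul hpos.le,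
    show (-(1 / 2 : ℝ)) * ((4 : ℕ) : ℝ) = -2 by norm_num, Real.rpow_neg hpos.le, Real.rpow_two,
    sq_abs, inv_mul_cancel₀ (pow_ne_zero 2 hd)]

/-- Over `ℝ`, `c⁴ d² = 1` has exactly the two solutions `c = ±|d|^{-1/2}`. [folklore] -/
theorem pow_four_mul_sq_eq_one_iff {d : ℝ} (hd : d ≠ 0) (c : ℝ) :
    c ^ 4 * d ^ 2 = 1 ↔ c = |d| ^ (-(1 / 2 : ℝ)) ∨ c = -|d| ^ (-(1 / 2 : ℝ)) := by
  obtain ⟨hpos, hspec⟩ := rpow_spec hd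
  set r := |d| ^ (-(1 / 2 : ℝ)) with hr
  constructor
  · intro h
    have hd2 : 0 < d ^ 2 := by positivity
    have h1 : c ^ 4 = r ^ 4 := by
      have : (c ^ 4 - r ^ 4) * d ^ 2 = 0 := by linear_combination h - hspec
      have := (mul_eq_zero.mp this).resolve_right hd2.ne'
      linarith
    have h2 : (c ^ 2 - r ^ 2) * (c ^ 2 + r ^ 2) = 0 := by linear_combination h1
    have hr2 : 0 < r ^ 2 := by positivity
    rcases mul_eq_zero.mp h2 with h3 | h3
    · have h4 : (c - r) * (c + r) = 0 := by linear_combination h3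
      rcases mul_eq_zero.mp h4 with h5 | h5
      · exact Or.inl (by linarith)
      · exact Or.inr (by linarith)
    · nlinarith [sq_nonneg c]
  · rintro (rfl | rfl)
    · exact hspec
    · rw [neg_pow, show ((-1 : ℝ)) ^ 4 = 1 by norm_num, one_mul]; exact hspec

/-- **`#Stab_{GL₂(ℝ)}(f) = 2 · #Stab_{PGL₂(ℝ)}(f)`**: each class of the twisted stabiliser modulo
`ℝˣ` contains exactly two plain stabilisers (`Δ(f) ≠ 0`). [cite: BhargavaShankarAnnals2015, Lemma 2.2] -/
theorem ncard_substStabilizer_eq (hΔ : f.disc ≠ 0) :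
    (substStabilizer f).ncard = 2 * pgl2StabilizerCard f := by
  -- the class map and a section of it
  set Cl : Set (Set (Matrix (Fin 2) (Fin 2) ℝ)) := stabilizerClass f '' stabilizerSet f with hCl
  -- for each class choose a representative in `Stab(f)`
  have hrep : ∀ C : Cl, ∃ γ : Matrix (Fin 2) (Fin 2) ℝ, γ ∈ stabilizerSet f ∧ stabilizerClass f γ = C := by
    rintro ⟨C, γ, hγ, rfl⟩; exact ⟨γ, hγ, rfl⟩
  choose rep hrep_mem hrep_cl using hrep
  -- the normalised representative `e C = |det|^{-1/2} rep C`, a plain stabiliser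
  set e : Cl → Matrix (Fin 2) (Fin 2) ℝ := fun C ↦ (|(rep C).det| ^ (-(1 / 2 : ℝ))) • rep C with he
  have he_mem : ∀ C, e C ∈ substStabilizer f := fun C ↦
    (smul_mem_substStabilizer_iff hΔ (hrep_mem C) _).mpr (rpow_spec (hrep_mem C).1).2
  have he_ne : ∀ C, e C ≠ 0 := fun C h0 ↦ by
    have := det_ne_zero_of_mem_substStabilizer hΔ (he_mem C)
    rw [h0, Matrix.det_zero] at this
    exact this rfl
  have he_cl : ∀ C, stabilizerClass f (e C) = C := fun C ↦ by
    rw [he, stabilizerClass_smul f (rpow_spec (hrep_mem C).1).1.ne', hrep_cl]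
  -- the bijection `Cl × Bool ≃ substStabilizer f`, `(C, b) ↦ ± e C`
  have key : ∀ γ ∈ substStabilizer f, ∃ C : Cl, γ = e C ∨ γ = -e C := by
    intro γ hγ
    have hγ' := mem_stabilizerSet_of_mem_substStabilizer hΔ hγ
    let C : Cl := ⟨stabilizerClass f γ, γ, hγ', rfl⟩
    refine ⟨C, ?_⟩
    -- `e C` is in the class of `γ`: `e C = c • γ`
    have hin : e C ∈ stabilizerClass f γ := by
      have : stabilizerClass f γ = stabilizerClass f (e C) := (he_cl C).symm
      rw [this]
      exact ⟨mem_stabilizerSet_of_mem_substStabilizer hΔ (he_mem C), 1, by rw [one_smul]⟩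
    obtain ⟨-, c, hc⟩ := hin
    -- both `γ` and `c • γ` are plain stabilisers, so `c⁴ = 1`, `c = ±1`
    have h1 : c ^ 4 * γ.det ^ 2 = 1 := (smul_mem_substStabilizer_iff hΔ hγ' c).mp (hc ▸ he_mem C)
    have h2 : γ.det ^ 2 = 1 := det_sq_eq_one_of_mem_substStabilizer hΔ hγ
    rw [h2, mul_one] at h1
    have h3 : (c - 1) * (c + 1) * (c ^ 2 + 1) = 0 := by linear_combination h1
    rcases mul_eq_zero.mp h3 with h4 | h4
    · rcases mul_eq_zero.mp h4 with h5 | h5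
      · left; rw [hc, show c = 1 by linarith, one_smul]
      · right; rw [hc, show c = -1 by linarith, neg_smul, one_smul, neg_neg]
    · nlinarith [sq_nonneg c]
  have hinj_aux : ∀ C C' : Cl, ∀ s : ℝ, s ≠ 0 → e C = s • e C' → C = C' := by
    intro C C' s hs heq
    apply Subtype.ext
    rw [← he_cl C, ← he_cl C', heq, stabilizerClass_smul f hs]
  let φ : Cl × Bool → substStabilizer f := fun Cb ↦
    if Cb.2 then ⟨e Cb.1, he_mem Cb.1⟩
    else ⟨-e Cb.1, by
      have := (smul_mem_substStabilizer_iff hΔ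
        (mem_stabilizerSet_of_mem_substStabilizer hΔ (he_mem Cb.1)) (-1)).mpr (by
          rw [det_sq_eq_one_of_mem_substStabilizer hΔ (he_mem Cb.1)]; norm_num)
      simpa using this⟩
  have hφ : Function.Bijective φ := by
    constructor
    · rintro ⟨C, b⟩ ⟨C', b'⟩ h
      simp only [φ] at h
      cases b <;> cases b' <;> simp only [Bool.false_eq_true, ↓reduceIte, Subtype.mk.injEq,
        neg_inj] at h
      · exact Prod.ext (hinj_aux C C' 1 one_ne_zero (by rw [one_smul]; exact h)) rfl
      · exfalso
        have h' : e C = (-1 : ℝ) • e C' := by rw [neg_one_smul, ← h, neg_neg]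
        have hCC := hinj_aux C C' (-1) (by norm_num) h'
        subst hCC
        exact he_ne C (by
          have : (2 : ℝ) • e C = 0 := by rw [two_smul]; nth_rewrite 1 [← h]; rw [neg_add_cancel]
          simpa using this)
      · exfalso
        have h' : e C = (-1 : ℝ) • e C' := by rw [neg_one_smul, h]
        have hCC := hinj_aux C C' (-1) (by norm_num) h'
        subst hCC
        exact he_ne C (by
          have : (2 : ℝ) • e C = 0 := by rw [two_smul]; nth_rewrite 2 [h]; rw [add_neg_cancel]
          simpa using this)
      · exact Prod.ext (hinj_aux C C' 1 one_ne_zero (by rw [one_smul]; exact h)) rfl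
    · rintro ⟨γ, hγ⟩
      obtain ⟨C, h | h⟩ := key γ hγ
      · exact ⟨(C, true), Subtype.ext (by simp [φ, h])⟩
      · exact ⟨(C, false), Subtype.ext (by simp [φ, h])⟩
  have hcard := Nat.card_eq_of_bijective φ hφ
  rw [Nat.card_prod, Nat.card_eq_fintype_card (α := Bool), Fintype.card_bool] at hcard
  rw [← Nat.card_coe_set_eq, ← hcard, pgl2StabilizerCard, ← Nat.card_coe_set_eq, mul_comm]

/-- The resolvent `φ³ − 3Iφ + J` as a `Cubic`, and its root set. [folklore] -/
theorem resolventRoots_eq_cubic_roots (g : BinaryQuartic ℝ) :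
    resolventRoots g = ((⟨1, 0, -3 * g.I, g.J⟩ : Cubic ℝ).roots.toFinset : Set ℝ) := by
  have hp : (⟨1, 0, -3 * g.I, g.J⟩ : Cubic ℝ).toPoly ≠ 0 := Cubic.ne_zero_of_a_ne_zero one_ne_zero
  ext φ
  rw [Finset.mem_coe, Multiset.mem_toFinset, Cubic.mem_roots_iff hp]
  simp only [resolventRoots, Set.mem_setOf_eq]
  constructor <;> intro h <;> linear_combination h

/-- The discriminant of the resolvent is `27² Δ(f)`. [folklore] -/
theorem discr_resolvent (g : BinaryQuartic ℝ) :
    (⟨1, 0, -3 * g.I, g.J⟩ : Cubic ℝ).discr = 27 * 27 * g.disc := by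
  have h := twentySeven_mul_disc g
  simp only [Cubic.discr]
  linear_combination (-27) * h

/-- **Bhargava–Shankar, Lemma 2.2, `i = 0` or `2`**: a real binary quartic form with `Δ > 0` has a
stabiliser of order `8` in `GL₂(ℝ)`. [cite: BhargavaShankarAnnals2015, Lemma 2.2] -/
theorem ncard_substStabilizer_of_disc_pos (hΔ : 0 < f.disc) : (substStabilizer f).ncard = 8 := by
  rw [ncard_substStabilizer_eq hΔ.ne', pgl2StabilizerCard_eq (by norm_num) (by norm_num) hΔ.ne',
    resolventRoots_eq_cubic_roots, Set.ncard_coe_finset,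
    Literature.Algebra.Polynomial.card_roots_eq_three_of_discr_pos (P := ⟨1, 0, -3 * f.I, f.J⟩)
      one_ne_zero (by rw [discr_resolvent]; positivity)]

/-- **Bhargava–Shankar, Lemma 2.2, `i = 1`**: a real binary quartic form with `Δ < 0` has a
stabiliser of order `4` in `GL₂(ℝ)`. [cite: BhargavaShankarAnnals2015, Lemma 2.2] -/
theorem ncard_substStabilizer_of_disc_neg (hΔ : f.disc < 0) : (substStabilizer f).ncard = 4 := by
  rw [ncard_substStabilizer_eq hΔ.ne, pgl2StabilizerCard_eq (by norm_num) (by norm_num) hΔ.ne,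
    resolventRoots_eq_cubic_roots, Set.ncard_coe_finset,
    Literature.Algebra.Polynomial.card_roots_eq_one_of_discr_neg (P := ⟨1, 0, -3 * f.I, f.J⟩)
      one_ne_zero (by rw [discr_resolvent]; linarith)]

/-- The `PGL₂(ℝ)`-stabiliser orders: `4` if `Δ > 0`, `2` if `Δ < 0` (the `n_i` of
Bhargava–Shankar, §2.1: `n₀ = n_{2±} = 4`, `n₁ = 2`). [cite: BhargavaShankarAnnals2015, §2.1 (n_i) and Lemma 2.2] -/
theorem pgl2StabilizerCard_real (hΔ : f.disc ≠ 0) :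
    pgl2StabilizerCard f = if 0 < f.disc then 4 else 2 := by
  split_ifs with h
  · have := ncard_substStabilizer_of_disc_pos h
    rw [ncard_substStabilizer_eq hΔ] at this
    omega
  · have h' : f.disc < 0 := lt_of_le_of_ne (not_lt.mp h) hΔ
    have := ncard_substStabilizer_of_disc_neg h'
    rw [ncard_substStabilizer_eq hΔ] at this
    omega

end BinaryQuartic

end Literature.NumberTheory.EllipticCurves

end
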